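import Literature.AnabelianGeometry.SemiGraphs.ProSigmaCompletionQuotientTransfer
import Mathlib.GroupTheory.SemidirectProduct
import HarnessLib

/-!
# Pro-`Σ` completions, IX: `P = closure ι(inl Δ) · closure ι(inr ℤ)` for a pro-`Σ` completion of `Δ ⋊_φ ℤ`

Parts V/VIII (`ProSigmaCompletionSemidirectCofinal.lean`) identify `Π := closure ι(inl Δ)` and
`T := closure ι(inr ℤ)` as pro-`Σ` completions of the fibre and of the section of `Δ ⋊_φ ℤ`.  Here: `Π` is NORMAL in
`P` (closure of the image of the normal subgroup `inl Δ` under the dense `ι`, part `QuotientTransfer`) and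
`Π ⊔ T = ⊤` — indeed `Π · T` is compact (image of `Π × T` under multiplication), hence closed, and contains the
dense image `ι(Δ ⋊ ℤ) = ι(inl Δ) · ι(inr ℤ)`.  This is the shape `Π_I = Π_𝔾 · I` of a DPSC-extension by a Dehn twist
([AbsTopII] Def. 1.2 (ii); [SemiAnbd] Ex. 2.10).  Theorems only; no side taken on [IUTchIII] Cor. 3.12.
[cite: MochizukiSemiAnbd2006, Ex. 2.10 p.31]
-/

namespace Literature.AnabelianGeometry.SemiGraphs.SemiGraphOfAnabelioids.IsProSigmaCompletion

open Literature.AnabelianGeometry.Anabelioids Topology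
open scoped Pointwise

namespace SemidirectCofinal

variable {Δ : Type*} [Group Δ] {Sigma : Set ℕ} (φ : Multiplicative ℤ →* MulAut Δ)
variable {P : Type*} [Group P] [TopologicalSpace P] [IsTopologicalGroup P]

/-- `closure ι(inl Δ)` is normal in `P` for `ι : Δ ⋊_φ ℤ → P` with dense range. [cite: MochizukiSemiAnbd2006, Ex. 2.10 p.31] -/
theorem normal_closure_map_range_inl {ι : (Δ ⋊[φ] Multiplicative ℤ) →* P} (hd : DenseRange ι) :
    (((SemidirectProduct.inl : Δ →* Δ ⋊[φ] Multiplicative ℤ).range.map ι).topologicalClosure).Normal := by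
  haveI : (SemidirectProduct.inl : Δ →* Δ ⋊[φ] Multiplicative ℤ).range.Normal := by
    rw [SemidirectProduct.range_inl_eq_ker_rightHom]
    infer_instance
  exact normal_topologicalClosure_map hd _

/-- **`P = closure ι(inl Δ) · closure ι(inr ℤ)`** for a homomorphism `ι : Δ ⋊_φ ℤ → P` with dense range into a
compact Hausdorff group: the product of the closed normal subgroup `closure ι(inl Δ)` and the compact subgroup
`closure ι(inr ℤ)` is closed and contains `ι(Δ ⋊ ℤ)`. [cite: MochizukiSemiAnbd2006, Ex. 2.10 p.31] -/
theorem closure_inl_sup_closure_inr_eq_top [CompactSpace P] [T2Space P] {ι : (Δ ⋊[φ] Multiplicative ℤ) →* P}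
    (hd : DenseRange ι) :
    ((SemidirectProduct.inl : Δ →* Δ ⋊[φ] Multiplicative ℤ).range.map ι).topologicalClosure ⊔
      ((SemidirectProduct.inr : Multiplicative ℤ →* Δ ⋊[φ] Multiplicative ℤ).range.map ι).topologicalClosure = ⊤ := by
  set A := ((SemidirectProduct.inl : Δ →* Δ ⋊[φ] Multiplicative ℤ).range.map ι).topologicalClosure with hA
  set T := ((SemidirectProduct.inr : Multiplicative ℤ →* Δ ⋊[φ] Multiplicative ℤ).range.map ι).topologicalClosure
    with hT
  haveI : A.Normal := normal_closure_map_range_inl φ hd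
  -- the carrier of `A ⊔ T` is the compact, hence closed, set `A * T`
  have hcarrier : ((A ⊔ T : Subgroup P) : Set P) = (A : Set P) * (T : Set P) := Subgroup.normal_mul A T
  have hclosed : IsClosed ((A ⊔ T : Subgroup P) : Set P) := by
    rw [hcarrier]
    have hAc : IsClosed (A : Set P) := Subgroup.isClosed_topologicalClosure _
    have hTc : IsClosed (T : Set P) := Subgroup.isClosed_topologicalClosure _
    exact (hAc.isCompact.mul hTc.isCompact).isClosed
  -- it contains the dense image of `ι`
  have hrange : Set.range ι ⊆ ((A ⊔ T : Subgroup P) : Set P) := by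
    rintro _ ⟨g, rfl⟩
    have hg : g = SemidirectProduct.inl g.left * SemidirectProduct.inr g.right := (SemidirectProduct.inl_left_mul_inr_right g).symm
    rw [hg, map_mul]
    refine (A ⊔ T).mul_mem (Subgroup.mem_sup_left ?_) (Subgroup.mem_sup_right ?_)
    · exact Subgroup.le_topologicalClosure _ ⟨SemidirectProduct.inl g.left, ⟨g.left, rfl⟩, rfl⟩
    · exact Subgroup.le_topologicalClosure _ ⟨SemidirectProduct.inr g.right, ⟨g.right, rfl⟩, rfl⟩
  -- so it is everything
  rw [eq_top_iff]
  intro p _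
  have hp : p ∈ closure (Set.range ι) := hd.closure_eq ▸ Set.mem_univ p
  exact (hclosed.closure_subset_iff.mpr hrange) hp

end SemidirectCofinal

end Literature.AnabelianGeometry.SemiGraphs.SemiGraphOfAnabelioids.IsProSigmaCompletion
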